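import Literature.MathematicalPhysics.QuantumLattice.SparseKrausPerturbedStateEnergy
import Literature.MathematicalPhysics.QuantumLattice.FermionGroundStatesMinimiseMeanEnergy
import Mathlib.Analysis.Matrix.Order
import Mathlib.Analysis.CStarAlgebra.ContinuousFunctionalCalculus.Unique
import HarnessLib

/-!
# Translation-invariant minimisers of the mean energy are ground states (lattice fermions)

Topic `Literature/MathematicalPhysics/QuantumLattice`; namespace
`Literature.MathematicalPhysics.QuantumLattice` (the file path). In the vocabulary of
`InfVolFermionState.lean` §6 (`FermionInteraction`, `IsGroundState`, `meanEnergy`,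
`IsMeanEnergyMinimiser`). Everything is PROVED; no named fact.

**Main theorem** (`InfVolFermionState.IsMeanEnergyMinimiser.isGroundState`). Let `Φ` be a Hermitian,
even, translation-invariant interaction of finite range `R` of a lattice fermion system on `ℤ^d`,
`d ≥ 1`, and let `ω` be a translation-invariant state minimising the mean energy `e_Φ` among all
translation-invariant states. Then `ω` is a ground state: `-i ω(A⋆ δ(A)) ≥ 0` for every local `A`
(`IsGroundState ω Φ R`). This is the implication `(2) ⇒ (1)` of Bratteli–Kishimoto–Robinson 1978,
Thm. 2 (for quantum spin systems; Ruelle 1969, Thm. 2/4, `Σ_Φ ⊆ ` ground states), here for EVEN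
interactions of lattice FERMIONS, where graded locality replaces locality. The converse `(1) ⇒ (2)` is
the tree's `FermionGroundStatesMinimiseMeanEnergy.lean`.

**Proof** (not the printed one — Ruelle's goes through unique tangent functionals of the pressure and
the density of differentiable interactions; we use the finite-range structure directly). Fix a region
`Λ` and a finite Kraus family `V_k ∈ 𝔄_Λ`, `Σ V_k⋆V_k = 1`, of homogeneous elements. Perturb `ω` by the
completely positive unital map `𝓔 = Σ_k V_k⋆(·)V_k` simultaneously at all translates `x + Λ`, `x` on a
sparse sublattice `x ≡ r (mod a)`, and average over `r ∈ (ℤ/aℤ)^d`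
(`SparseKrausPerturbedState*.lean`): the result `ω̄` is a translation-invariant state with
`e_Φ(ω̄) = e_Φ(ω) + a^{-d} Re[ω(𝓔(H)) − ω(H)]`, `H = H_{Λ_R}` (after discarding the terms of `H_U`,
`U ⊇ Λ_R`, that `𝓔` fixes). Minimality gives the **complete-positivity stability**
`Re ω(𝓔(H)) ≥ Re ω(H)` (§3). Applied to the Kraus PAIR `V₁ = tA`, `V₂ = √(1 − t²A⋆A)` (continuous
functional calculus; `V₂` is even, §1) and expanded to second order in `t` (§2:
`‖1 − V₂‖ ≤ t²‖A⋆A‖`, `‖1 − V₂ − ½t²A⋆A‖ ≤ ½t⁴‖A⋆A‖²`) it yields, as `t → 0`, the Bratteli–Robinson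
inequality `Re ω((ΓA)⋆[H, ΓA]) ≥ 0` for homogeneous `A`; a general `A` is the sum of its even and odd
parts and the cross terms are odd, so they have zero expectation in the (even, by
`TranslationInvariantFermionStatesAreEven`) state `ω` (§4). Local stability implies stationarity
(`expect_commutator_eq_zero_of_localStability`), which makes `ω((ΓA)⋆[H,ΓA])` real, and
`-i ω(A⋆δ(A)) = ω((ΓA)⋆[H,ΓA]) ≥ 0`.

## References

* [BratteliKishimotoRobinson1978] O. Bratteli, A. Kishimoto, D. W. Robinson, *Ground states of quantum
  spin systems*, Commun. Math. Phys. 64 (1978) 41–48, Thm. 2 (`1 ⇔ 2`) and proof of Thm. 1.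
* [Ruelle1969GroundState] D. Ruelle, *Some remarks on the ground state of infinite systems in
  statistical mechanics*, Commun. Math. Phys. 11 (1969) 339–345, Thm. 2 and Thm. 4.
* [BratteliRobinsonII1997] OAQSM 2, Def. 5.3.18, Prop. 5.3.19, Thm. 6.2.58.
* [ArakiMoriya2003] H. Araki, H. Moriya, Rev. Math. Phys. 15 (2003) 93–198, §7, §12 (fermionic
  variational principle; even states).
-/

noncomputable section

namespace Literature.MathematicalPhysics.QuantumLattice

open Matrix Finset HubbardWave0 Literature.Probability.LatticeModels
open scoped ComplexOrder

variable {d : ℕ}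

/-! ### §1. The Kraus pair `(tA, √(1 − t²A⋆A))`: continuous functional calculus -/

section CFCKit

variable {Λ' : Finset (Site d)}

/-- `0 ≤ 1 − √(1−u) ≤ u` on `[0,1]`. [folklore] -/
private theorem one_sub_sqrt_bounds {u : ℝ} (h0 : 0 ≤ u) (h1 : u ≤ 1) :
    0 ≤ 1 - Real.sqrt (1 - u) ∧ 1 - Real.sqrt (1 - u) ≤ u := by
  have hs0 : 0 ≤ Real.sqrt (1 - u) := Real.sqrt_nonneg _
  have hs2 : Real.sqrt (1 - u) ^ 2 = 1 - u := Real.sq_sqrt (by linarith)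
  have hs1 : Real.sqrt (1 - u) ≤ 1 := by nlinarith
  refine ⟨by linarith, ?_⟩
  nlinarith [mul_nonneg hs0 (sub_nonneg.2 hs1)]

/-- `0 ≤ 1 − √(1−u) − u/2 ≤ u²/2` on `[0,1]`. [folklore] -/
private theorem one_sub_sqrt_sub_half_bounds {u : ℝ} (h0 : 0 ≤ u) (h1 : u ≤ 1) :
    0 ≤ 1 - Real.sqrt (1 - u) - u / 2 ∧ 1 - Real.sqrt (1 - u) - u / 2 ≤ u ^ 2 / 2 := by
  have hs0 : 0 ≤ Real.sqrt (1 - u) := Real.sqrt_nonneg _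
  constructor
  · have h : Real.sqrt (1 - u) ≤ 1 - u / 2 := by
      rw [Real.sqrt_le_left (by linarith)]; nlinarith
    linarith
  · by_cases hq : 1 - u / 2 - u ^ 2 / 2 < 0
    · linarith
    · have hq' : 0 ≤ 1 - u / 2 - u ^ 2 / 2 := le_of_not_gt hq
      have hpoly : (1 - u / 2 - u ^ 2 / 2) ^ 2 ≤ 1 - u := by
        nlinarith [mul_nonneg (mul_nonneg (sq_nonneg u) (sub_nonneg.2 h1)) (by linarith : (0:ℝ) ≤ 3 + u)]
      have h : 1 - u / 2 - u ^ 2 / 2 ≤ Real.sqrt (1 - u) := Real.le_sqrt_of_sq_le hpoly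
      linarith

/-- **The second Kraus operator** `S_t(N) = √(1 − t²N)` of the pair `(tA, √(1 − t²A⋆A))`, `N = A⋆A`,
defined by the (real) continuous functional calculus of the self-adjoint `N` (Bratteli–Kishimoto–Robinson
perturb by the semigroup `e^{tγ_B}`, `γ_B(A) = B⋆AB − ½(B⋆BA + AB⋆B)`; `(tA, S_t)` is its one-step Kraus
discretisation). [cite: BratteliKishimotoRobinson1978, Thm. 1 (proof, the generator γ_B)] -/
def krausSqrt (t : ℝ) (N : FermionOp Λ') : FermionOp Λ' :=
  cfc (fun x : ℝ => Real.sqrt (1 - t ^ 2 * x)) N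

/-- `S_t` is self-adjoint. [cite: BratteliKishimotoRobinson1978, Thm. 1 (proof)] -/
theorem krausSqrt_isSelfAdjoint (t : ℝ) (N : FermionOp Λ') : IsSelfAdjoint (krausSqrt t N) :=
  cfc_predicate _ _

/-- `S_tᴴ = S_t`. [cite: BratteliKishimotoRobinson1978, Thm. 1 (proof)] -/
theorem krausSqrt_conjTranspose (t : ℝ) (N : FermionOp Λ') : (krausSqrt t N)ᴴ = krausSqrt t N := by
  rw [← Matrix.star_eq_conjTranspose]
  exact (krausSqrt_isSelfAdjoint t N).star_eq

/-- `A⋆A` is self-adjoint. [folklore] -/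
private theorem isSelfAdjoint_conjTranspose_mul_self (B : FermionOp Λ') : IsSelfAdjoint (Bᴴ * B) := by
  rw [IsSelfAdjoint, Matrix.star_eq_conjTranspose, Matrix.conjTranspose_mul,
    Matrix.conjTranspose_conjTranspose]

/-- **Kraus completeness of the pair**: `S_t² = 1 − t²N` as soon as `t²x ≤ 1` on the spectrum of `N`.
[cite: BratteliKishimotoRobinson1978, Thm. 1 (proof)] -/
theorem krausSqrt_mul_self {t : ℝ} {N : FermionOp Λ'} (hN : IsSelfAdjoint N)
    (hsp : ∀ x ∈ spectrum ℝ N, t ^ 2 * x ≤ 1) :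
    krausSqrt t N * krausSqrt t N = 1 - (t ^ 2) • N := by
  unfold krausSqrt
  rw [← cfc_mul (fun x : ℝ => Real.sqrt (1 - t ^ 2 * x)) (fun x : ℝ => Real.sqrt (1 - t ^ 2 * x)) N]
  have h1 : cfc (fun x : ℝ => Real.sqrt (1 - t ^ 2 * x) * Real.sqrt (1 - t ^ 2 * x)) N =
      cfc (fun x : ℝ => 1 - t ^ 2 * x) N :=
    cfc_congr fun x hx => Real.mul_self_sqrt (by linarith [hsp x hx])
  rw [h1, cfc_sub (fun _ : ℝ => (1 : ℝ)) (fun x : ℝ => t ^ 2 * x) N, cfc_const_one ℝ N,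
    cfc_const_mul (t ^ 2) (fun x : ℝ => x) N, cfc_id' ℝ N]

/-- Real scalars act on `𝔄_Λ` through `ℝ ⊆ ℂ`. [folklore] -/
private theorem real_smul_eq_coe_smul (r : ℝ) (M : FermionOp Λ') : r • M = (r : ℂ) • M := by
  ext i j
  simp only [Matrix.smul_apply, Complex.real_smul, smul_eq_mul]

/-- `(tA)⋆(tA) + S_t⋆ S_t = 1` for `S_t = √(1 − t²A⋆A)`, `t²x ≤ 1` on `σ(A⋆A)`.
[cite: BratteliKishimotoRobinson1978, Thm. 1 (proof)] -/
theorem krausPair_complete {t : ℝ} (A : FermionOp Λ') (hsp : ∀ x ∈ spectrum ℝ (Aᴴ * A), t ^ 2 * x ≤ 1) :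
    ((t : ℂ) • A)ᴴ * ((t : ℂ) • A) + (krausSqrt t (Aᴴ * A))ᴴ * krausSqrt t (Aᴴ * A) = 1 := by
  rw [krausSqrt_conjTranspose, krausSqrt_mul_self (isSelfAdjoint_conjTranspose_mul_self A) hsp,
    Matrix.conjTranspose_smul, Matrix.smul_mul, Matrix.mul_smul, smul_smul, Complex.star_def,
    Complex.conj_ofReal, real_smul_eq_coe_smul, Complex.ofReal_pow, ← pow_two, add_sub_cancel]

/-- The even–odd automorphism `Θ` as a `⋆`-algebra homomorphism of `𝔄_Λ`. [cite: ArakiMoriya2003, §4.1 Def. 4.2] -/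
def parityStarAlgHom (Λ' : Finset (Site d)) : FermionOp Λ' →⋆ₐ[ℂ] FermionOp Λ' :=
  { (parityAut : FermionOp Λ' →ₐ[ℂ] FermionOp Λ') with
    map_star' := fun b => by
      change parityAut (star b) = star (parityAut b)
      rw [Matrix.star_eq_conjTranspose, Matrix.star_eq_conjTranspose, parityAut_conjTranspose] }

/-- `parityStarAlgHom` is `Θ`. [cite: ArakiMoriya2003, §4.1 Def. 4.2] -/
@[simp] theorem parityStarAlgHom_apply (b : FermionOp Λ') : parityStarAlgHom Λ' b = parityAut b := rfl

/-- The isotony embedding `Γ : 𝔄_Λ → 𝔄_{Λ'}` as a `⋆`-algebra homomorphism. [cite: ArakiMoriya2003, §4.1 (isotony)] -/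
def fermionEmbedStarAlgHom {Λ Λ' : Finset (Site d)} (h : Λ ⊆ Λ') : FermionOp Λ →⋆ₐ[ℂ] FermionOp Λ' :=
  { (fermionEmbed (PolySite.incl h) : FermionOp Λ →ₐ[ℂ] FermionOp Λ') with
    map_star' := fun b => by
      change fermionEmbed (PolySite.incl h) (star b) = star (fermionEmbed (PolySite.incl h) b)
      rw [Matrix.star_eq_conjTranspose, Matrix.star_eq_conjTranspose, fermionEmbed_conjTranspose] }

/-- `fermionEmbedStarAlgHom` is `Γ`. [cite: ArakiMoriya2003, §4.1 (isotony)] -/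
@[simp] theorem fermionEmbedStarAlgHom_apply {Λ Λ' : Finset (Site d)} (h : Λ ⊆ Λ') (b : FermionOp Λ) :
    fermionEmbedStarAlgHom h b = fermionEmbed (PolySite.incl h) b := rfl

/-- **`S_t` is covariant under `Θ`**: `Θ(S_t(N)) = S_t(Θ N)`; in particular `S_t(A⋆A)` is EVEN for a
homogeneous `A` (the functional calculus commutes with `⋆`-automorphisms).
[cite: ArakiMoriya2003, §4.1 (Θ-invariance)] -/
theorem parityAut_krausSqrt (t : ℝ) {N : FermionOp Λ'} (hN : IsSelfAdjoint N) :
    parityAut (krausSqrt t N) = krausSqrt t (parityAut N) := by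
  have hcont : Continuous (parityStarAlgHom Λ') :=
    LinearMap.continuous_of_finiteDimensional ((parityStarAlgHom Λ').toLinearMap)
  have hN' : IsSelfAdjoint (parityStarAlgHom Λ' N) := by
    rw [parityStarAlgHom_apply, IsSelfAdjoint, Matrix.star_eq_conjTranspose, ← parityAut_conjTranspose,
      ← Matrix.star_eq_conjTranspose, hN.star_eq]
  exact (parityStarAlgHom Λ').map_cfc (S := ℂ) (fun x : ℝ => Real.sqrt (1 - t ^ 2 * x)) N
    (hφ := hcont) (ha := hN) (hφa := hN')

/-- **`S_t` is covariant under isotony**: `Γ(S_t(N)) = S_t(Γ N)`. [cite: ArakiMoriya2003, §4.1 (isotony)] -/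
theorem fermionEmbed_krausSqrt {Λ : Finset (Site d)} (hΛ : Λ ⊆ Λ') (t : ℝ) {N : FermionOp Λ}
    (hN : IsSelfAdjoint N) :
    fermionEmbed (PolySite.incl hΛ) (krausSqrt t N) = krausSqrt t (fermionEmbed (PolySite.incl hΛ) N) := by
  have hcont : Continuous (fermionEmbedStarAlgHom hΛ) :=
    LinearMap.continuous_of_finiteDimensional ((fermionEmbedStarAlgHom hΛ).toLinearMap)
  have hN' : IsSelfAdjoint (fermionEmbedStarAlgHom hΛ N) := by
    rw [fermionEmbedStarAlgHom_apply, IsSelfAdjoint, Matrix.star_eq_conjTranspose, ← fermionEmbed_conjTranspose,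
      ← Matrix.star_eq_conjTranspose, hN.star_eq]
  exact (fermionEmbedStarAlgHom hΛ).map_cfc (S := ℂ) (fun x : ℝ => Real.sqrt (1 - t ^ 2 * x)) N
    (hφ := hcont) (ha := hN) (hφa := hN')

open scoped Matrix.Norms.L2Operator

/-- The (real) spectrum of a self-adjoint element is bounded by its norm. [folklore] -/
private theorem le_norm_of_mem_spectrum {N : FermionOp Λ'} (hN : IsSelfAdjoint N) {x : ℝ} (hx : x ∈ spectrum ℝ N) :
    x ≤ ‖N‖ := by
  have h := norm_apply_le_norm_cfc (fun y : ℝ => y) N hx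
  rw [cfc_id' ℝ N, Real.norm_eq_abs] at h
  exact (le_abs_self x).trans h

/-- The spectrum of `A⋆A` is nonnegative. [folklore] -/
private theorem spectrum_nonneg_of_conjTranspose_mul_self (B : FermionOp Λ') {x : ℝ} (hx : x ∈ spectrum ℝ (Bᴴ * B)) :
    0 ≤ x := by
  have hP : (Bᴴ * B).PosSemidef := Matrix.posSemidef_conjTranspose_mul_self B
  rw [hP.1.spectrum_real_eq_range_eigenvalues] at hx
  obtain ⟨i, rfl⟩ := hx
  exact hP.eigenvalues_nonneg i

/-- `t²x ≤ 1` on `σ(A⋆A)` as soon as `t²‖A⋆A‖ ≤ 1`. [folklore] -/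
private theorem spectrum_smallness (B : FermionOp Λ') {t : ℝ} (ht : t ^ 2 * ‖Bᴴ * B‖ ≤ 1) :
    ∀ x ∈ spectrum ℝ (Bᴴ * B), t ^ 2 * x ≤ 1 := fun _ hx =>
  (mul_le_mul_of_nonneg_left (le_norm_of_mem_spectrum (isSelfAdjoint_conjTranspose_mul_self B) hx)
    (sq_nonneg t)).trans ht

/-- **First-order size of the second Kraus operator**: `‖1 − S_t‖ ≤ t²‖A⋆A‖` (`t²‖A⋆A‖ ≤ 1`).
[cite: BratteliKishimotoRobinson1978, Thm. 1 (proof: expansion of e^{tγ_B})] -/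
theorem norm_one_sub_krausSqrt_le (B : FermionOp Λ') {t : ℝ} (ht : t ^ 2 * ‖Bᴴ * B‖ ≤ 1) :
    ‖1 - krausSqrt t (Bᴴ * B)‖ ≤ t ^ 2 * ‖Bᴴ * B‖ := by
  have hN := isSelfAdjoint_conjTranspose_mul_self B
  have h1 : 1 - krausSqrt t (Bᴴ * B) = cfc (fun x : ℝ => 1 - Real.sqrt (1 - t ^ 2 * x)) (Bᴴ * B) := by
    rw [krausSqrt, cfc_sub (fun _ : ℝ => (1 : ℝ)) (fun x : ℝ => Real.sqrt (1 - t ^ 2 * x)) (Bᴴ * B),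
      cfc_const_one ℝ (Bᴴ * B)]
  rw [h1]
  refine norm_cfc_le (by positivity) fun x hx => ?_
  have hx0 := spectrum_nonneg_of_conjTranspose_mul_self B hx
  have hx1 : t ^ 2 * x ≤ t ^ 2 * ‖Bᴴ * B‖ :=
    mul_le_mul_of_nonneg_left (le_norm_of_mem_spectrum hN hx) (sq_nonneg t)
  obtain ⟨ha, hb⟩ := one_sub_sqrt_bounds (u := t ^ 2 * x) (by positivity) (hx1.trans ht)
  rw [Real.norm_eq_abs, abs_of_nonneg ha]
  exact hb.trans hx1

/-- **Second-order size**: `‖1 − S_t − ½t²A⋆A‖ ≤ ½(t²‖A⋆A‖)²` (`t²‖A⋆A‖ ≤ 1`).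
[cite: BratteliKishimotoRobinson1978, Thm. 1 (proof: expansion of e^{tγ_B})] -/
theorem norm_one_sub_krausSqrt_sub_smul_le (B : FermionOp Λ') {t : ℝ} (ht : t ^ 2 * ‖Bᴴ * B‖ ≤ 1) :
    ‖1 - krausSqrt t (Bᴴ * B) - ((t ^ 2 / 2 : ℝ) : ℂ) • (Bᴴ * B)‖ ≤ (t ^ 2 * ‖Bᴴ * B‖) ^ 2 / 2 := by
  have hN := isSelfAdjoint_conjTranspose_mul_self B
  have h1 : 1 - krausSqrt t (Bᴴ * B) - ((t ^ 2 / 2 : ℝ) : ℂ) • (Bᴴ * B) =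
      cfc (fun x : ℝ => 1 - Real.sqrt (1 - t ^ 2 * x) - t ^ 2 / 2 * x) (Bᴴ * B) := by
    rw [krausSqrt, cfc_sub (fun x : ℝ => 1 - Real.sqrt (1 - t ^ 2 * x)) (fun x : ℝ => t ^ 2 / 2 * x) (Bᴴ * B),
      cfc_sub (fun _ : ℝ => (1 : ℝ)) (fun x : ℝ => Real.sqrt (1 - t ^ 2 * x)) (Bᴴ * B),
      cfc_const_one ℝ (Bᴴ * B), cfc_const_mul (t ^ 2 / 2) (fun x : ℝ => x) (Bᴴ * B), cfc_id' ℝ (Bᴴ * B),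
      real_smul_eq_coe_smul]
  rw [h1]
  refine norm_cfc_le (by positivity) fun x hx => ?_
  have hx0 := spectrum_nonneg_of_conjTranspose_mul_self B hx
  have hx1 : t ^ 2 * x ≤ t ^ 2 * ‖Bᴴ * B‖ :=
    mul_le_mul_of_nonneg_left (le_norm_of_mem_spectrum hN hx) (sq_nonneg t)
  have hu0 : 0 ≤ t ^ 2 * x := by positivity
  obtain ⟨ha, hb⟩ := one_sub_sqrt_sub_half_bounds (u := t ^ 2 * x) hu0 (hx1.trans ht)
  have hrew : 1 - Real.sqrt (1 - t ^ 2 * x) - t ^ 2 / 2 * x = 1 - Real.sqrt (1 - t ^ 2 * x) - t ^ 2 * x / 2 := by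
    ring
  rw [hrew, Real.norm_eq_abs, abs_of_nonneg ha]
  refine hb.trans ?_
  have : (t ^ 2 * x) ^ 2 ≤ (t ^ 2 * ‖Bᴴ * B‖) ^ 2 := pow_le_pow_left₀ hu0 hx1 2
  linarith

end CFCKit

/-! ### §2. From complete-positivity stability to the Bratteli–Robinson inequality -/

namespace InfVolFermionState

open scoped Matrix.Norms.L2Operator in
/-- **The infinitesimal step.** Let `H = H⋆ ∈ 𝔄_{Λ'}`, `B ∈ 𝔄_{Λ'}`, and suppose that for all small
`t > 0` the state `ω` does not gain energy under the Kraus pair `(tB, S_t)`, `S_t = √(1 − t²B⋆B)`: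
`Re ω(H) ≤ Re ω((tB)⋆H(tB) + S_t H S_t)`. Then `Re ω(B⋆[H, B]) ≥ 0` — expand
`S_t = 1 − ½t²B⋆B + O(t⁴)`: the first-order terms give `t²·Re ω(B⋆HB − B⋆BH)`, the rest is `O(t⁴)`.
(Bratteli–Kishimoto–Robinson differentiate `t ↦ ω(e^{tγ_B}(H))` at `t = 0`.)
[cite: BratteliKishimotoRobinson1978, Thm. 1 (proof, `2 ⇒ 1`)] -/
theorem re_expect_conj_commutator_nonneg_of_cpStable (ω : InfVolFermionState d) {Λ' : Finset (Site d)}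
    {H : FermionOp Λ'} (hH : H.IsHermitian) (B : FermionOp Λ') {t₁ : ℝ} (ht₁ : 0 < t₁)
    (hstab : ∀ t : ℝ, 0 < t → t ≤ t₁ →
      (ω.expect Λ' H).re ≤ (ω.expect Λ' (((t : ℂ) • B)ᴴ * H * ((t : ℂ) • B) +
        (krausSqrt t (Bᴴ * B))ᴴ * H * krausSqrt t (Bᴴ * B))).re) :
    0 ≤ (ω.expect Λ' (Bᴴ * (H * B - B * H))).re := by
  have hNsa : (Bᴴ * B)ᴴ = Bᴴ * B := by rw [Matrix.conjTranspose_mul, Matrix.conjTranspose_conjTranspose]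
  -- `c = Re ω(B⋆HB) − Re ω(B⋆B H)`
  have hc : (ω.expect Λ' (Bᴴ * (H * B - B * H))).re =
      (ω.expect Λ' (Bᴴ * H * B)).re - (ω.expect Λ' (Bᴴ * B * H)).re := by
    rw [Matrix.mul_sub, ← Matrix.mul_assoc, ← Matrix.mul_assoc, map_sub, Complex.sub_re]
  -- `Re ω(H B⋆B) = Re ω(B⋆B H)`
  have hHN : (ω.expect Λ' (H * (Bᴴ * B))).re = (ω.expect Λ' (Bᴴ * B * H)).re := by
    have : H * (Bᴴ * B) = (Bᴴ * B * H)ᴴ := by rw [Matrix.conjTranspose_mul, hH.eq, hNsa]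
    rw [this, ω.expect_conjTranspose, Complex.star_def, Complex.conj_re]
  -- the two norm bounds and the smallness facts, then generalize the operators away
  have key : ∀ t : ℝ, 0 < t → t ≤ t₁ → t ^ 2 * ‖Bᴴ * B‖ ≤ 1 →
      0 ≤ t ^ 2 * (ω.expect Λ' (Bᴴ * (H * B - B * H))).re + 2 * ((t ^ 2 * ‖Bᴴ * B‖) ^ 2 * ‖H‖) := by
    intro t ht0 ht1 htn
    have hst := hstab t ht0 ht1
    have hSsa : (krausSqrt t (Bᴴ * B))ᴴ = krausSqrt t (Bᴴ * B) := krausSqrt_conjTranspose t _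
    have hDn := norm_one_sub_krausSqrt_le B htn
    have hEn := norm_one_sub_krausSqrt_sub_smul_le B htn
    have h1 : ((t : ℂ) • B)ᴴ * H * ((t : ℂ) • B) = ((t ^ 2 : ℝ) : ℂ) • (Bᴴ * H * B) := by
      rw [Matrix.conjTranspose_smul, Matrix.smul_mul, Matrix.smul_mul, Matrix.mul_smul, smul_smul,
        Complex.star_def, Complex.conj_ofReal, Complex.ofReal_pow, pow_two]
    rw [h1, hSsa] at hst
    rw [hc]
    -- name the operators
    obtain ⟨S, hS⟩ : ∃ S, krausSqrt t (Bᴴ * B) = S := ⟨_, rfl⟩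
    rw [hS] at hst hDn hEn
    obtain ⟨N, hN⟩ : ∃ N, Bᴴ * B = N := ⟨_, rfl⟩
    rw [hN] at hDn hEn hHN ⊢
    set D : FermionOp Λ' := 1 - S with hDdef
    set E : FermionOp Λ' := 1 - S - ((t ^ 2 / 2 : ℝ) : ℂ) • N with hEdef
    have hSD : S = 1 - D := by rw [hDdef, sub_sub_cancel]
    have hDE : D = E + ((t ^ 2 / 2 : ℝ) : ℂ) • N := by rw [hEdef, hDdef, sub_add_cancel]
    -- expand `S H S`
    have h2 : S * H * S = H - (D * H + H * D) + D * H * D := by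
      rw [hSD]; noncomm_ring
    have h3 : D * H + H * D = (E * H + H * E) + ((t ^ 2 / 2 : ℝ) : ℂ) • (N * H + H * N) := by
      rw [hDE, Matrix.add_mul, Matrix.mul_add, Matrix.smul_mul, Matrix.mul_smul, smul_add]; abel
    have hre : (ω.expect Λ' (((t ^ 2 : ℝ) : ℂ) • (Bᴴ * H * B) + S * H * S)).re =
        t ^ 2 * (ω.expect Λ' (Bᴴ * H * B)).re + ((ω.expect Λ' H).re
          - ((ω.expect Λ' (E * H)).re + (ω.expect Λ' (H * E)).re + t ^ 2 * (ω.expect Λ' (N * H)).re)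
          + (ω.expect Λ' (D * H * D)).re) := by
      rw [h2, h3]
      simp only [map_add, map_sub, map_smul, smul_eq_mul, Complex.add_re, Complex.sub_re,
        Complex.re_ofReal_mul, hHN]
      ring
    rw [hre] at hst
    -- bounds on the error terms
    have e1 : |(ω.expect Λ' (E * H)).re| ≤ (t ^ 2 * ‖N‖) ^ 2 / 2 * ‖H‖ :=
      (ω.abs_re_expect_le Λ' _).trans ((norm_mul_le _ _).trans (mul_le_mul_of_nonneg_right hEn (norm_nonneg _)))
    have e2 : |(ω.expect Λ' (H * E)).re| ≤ ‖H‖ * ((t ^ 2 * ‖N‖) ^ 2 / 2) :=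
      (ω.abs_re_expect_le Λ' _).trans ((norm_mul_le _ _).trans (mul_le_mul_of_nonneg_left hEn (norm_nonneg _)))
    have e3 : |(ω.expect Λ' (D * H * D)).re| ≤ (t ^ 2 * ‖N‖) * ‖H‖ * (t ^ 2 * ‖N‖) := by
      refine (ω.abs_re_expect_le Λ' _).trans ((norm_mul_le _ _).trans ?_)
      exact mul_le_mul ((norm_mul_le _ _).trans (mul_le_mul_of_nonneg_right hDn (norm_nonneg _)))
        hDn (norm_nonneg _) (by positivity)
    rw [abs_le] at e1 e2 e3
    nlinarith [e1.1, e1.2, e2.1, e2.2, e3.1, e3.2]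
  -- conclude by taking `t` small
  obtain ⟨n, hn⟩ : ∃ n, ‖Bᴴ * B‖ = n := ⟨_, rfl⟩
  obtain ⟨h, hh⟩ : ∃ h, ‖H‖ = h := ⟨_, rfl⟩
  obtain ⟨c, hcc⟩ : ∃ c, (ω.expect Λ' (Bᴴ * (H * B - B * H))).re = c := ⟨_, rfl⟩
  have hn0 : 0 ≤ n := hn ▸ norm_nonneg _
  have hh0 : 0 ≤ h := hh ▸ norm_nonneg _
  rw [hn, hh, hcc] at key
  by_contra hneg
  push Not at hneg
  -- choose `t² = ε` with `ε ≤ t₁²`, `ε n ≤ 1`, `ε (4 n² h + 1) ≤ -c`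
  obtain ⟨ε, hε0, hε1, hε2, hε3⟩ :
      ∃ ε : ℝ, 0 < ε ∧ ε ≤ t₁ ^ 2 ∧ ε * n ≤ 1 ∧ ε * (4 * (n ^ 2 * h) + 1) ≤ -c := by
    have hpos : 0 < 4 * (n ^ 2 * h) + 1 := by positivity
    refine ⟨min (min (t₁ ^ 2) (1 / (n + 1))) (-c / (4 * (n ^ 2 * h) + 1)), ?_, ?_, ?_, ?_⟩
    · exact lt_min (lt_min (pow_pos ht₁ 2) (by positivity)) (div_pos (by linarith) hpos)
    · exact (min_le_left _ _).trans (min_le_left _ _)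
    · have h1 : min (min (t₁ ^ 2) (1 / (n + 1))) (-c / (4 * (n ^ 2 * h) + 1)) ≤ 1 / (n + 1) :=
        (min_le_left _ _).trans (min_le_right _ _)
      calc min (min (t₁ ^ 2) (1 / (n + 1))) (-c / (4 * (n ^ 2 * h) + 1)) * n ≤ 1 / (n + 1) * n :=
            mul_le_mul_of_nonneg_right h1 hn0
        _ ≤ 1 := by rw [div_mul_eq_mul_div, one_mul, div_le_one (by positivity)]; linarith
    · have h1 : min (min (t₁ ^ 2) (1 / (n + 1))) (-c / (4 * (n ^ 2 * h) + 1)) ≤ -c / (4 * (n ^ 2 * h) + 1) :=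
        min_le_right _ _
      calc min (min (t₁ ^ 2) (1 / (n + 1))) (-c / (4 * (n ^ 2 * h) + 1)) * (4 * (n ^ 2 * h) + 1)
          ≤ -c / (4 * (n ^ 2 * h) + 1) * (4 * (n ^ 2 * h) + 1) := mul_le_mul_of_nonneg_right h1 hpos.le
        _ = -c := div_mul_cancel₀ _ hpos.ne'
  have ht0 : 0 < Real.sqrt ε := Real.sqrt_pos.2 hε0
  have ht2 : Real.sqrt ε ^ 2 = ε := Real.sq_sqrt hε0.le
  have ht1 : Real.sqrt ε ≤ t₁ := by
    rw [Real.sqrt_le_left ht₁.le]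
    exact hε1
  have hk := key (Real.sqrt ε) ht0 ht1 (by rw [ht2]; exact hε2)
  rw [ht2] at hk
  nlinarith [mul_nonneg hε0.le (mul_nonneg (sq_nonneg n) hh0), mul_nonneg hε0.le hε0.le]

end InfVolFermionState

/-! ### §3. Complete-positivity stability of a translation-invariant minimiser -/

/-- A bound on all coordinates of the points of a finite region. [cite: BratteliRobinsonII1997, §6.2.1] -/
def coordBound (Λ : Finset (Site d)) : ℕ := Λ.sup fun x => Finset.univ.sup fun i => (x i).natAbs

/-- Every coordinate is bounded by `coordBound`. [cite: BratteliRobinsonII1997, §6.2.1] -/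
theorem natAbs_apply_le_coordBound {Λ : Finset (Site d)} {x : Site d} (hx : x ∈ Λ) (i : Fin d) :
    (x i).natAbs ≤ coordBound Λ :=
  le_trans (Finset.le_sup (f := fun i => (x i).natAbs) (Finset.mem_univ i))
    (Finset.le_sup (f := fun x : Site d => Finset.univ.sup fun i => (x i).natAbs) hx)

/-- Coordinate differences inside `Λ`, plus `k`, stay below `2·coordBound Λ + k + 1`.
[cite: BratteliRobinsonII1997, §6.2.1] -/
theorem sub_apply_add_lt_of_mem {Λ : Finset (Site d)} {x y : Site d} (hx : x ∈ Λ) (hy : y ∈ Λ)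
    (i : Fin d) (k : ℕ) : x i - y i + k < ((2 * coordBound Λ + k + 1 : ℕ) : ℤ) := by
  have h1 := natAbs_apply_le_coordBound hx i
  have h2 := natAbs_apply_le_coordBound hy i
  push_cast
  omega

/-- **The Kraus pattern at `Λ`**: the Kraus family `V` placed at `Λ`, to be repeated with spacing
`a = 2·coordBound Λ + ⌊R⌋ + 1` (larger than the extent of `Λ` plus the range).
[cite: BratteliKishimotoRobinson1978, Thm. 2 (proof)] -/
def krausPatternAt (Λ : Finset (Site d)) (R : ℝ) {m : ℕ} (V : Fin m → FermionOp Λ)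
    (hV : ∑ k, (V k)ᴴ * V k = 1) (hhom : ∀ k, parityAut (V k) = V k ∨ parityAut (V k) = -V k) :
    KrausPattern d where
  Λ₀ := Λ
  m := m
  V := V
  a := 2 * coordBound Λ + ⌊R⌋₊ + 1
  sum_conjTranspose_mul := hV
  homogeneous := hhom
  sub_lt x hx y hy i := by
    have h := sub_apply_add_lt_of_mem hx hy i ⌊R⌋₊
    push_cast at h ⊢
    linarith

namespace InfVolFermionState

/-- **Complete-positivity stability of a minimiser.** If the translation-invariant state `ω` minimises
the mean energy of the even, translation-invariant, finite-range interaction `Φ`, then for every region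
`Λ` and every finite Kraus family `V_k ∈ 𝔄_Λ` of homogeneous elements with `Σ_k V_k⋆V_k = 1`:
`Re ω(H_{Λ_R}) ≤ Re ω(Σ_k (ΓV_k)⋆ H_{Λ_R} (ΓV_k))` — the energy of `ω` near `Λ` is not lowered by the
completely positive unital perturbation `𝓔 = Σ_k V_k⋆(·)V_k` (else repeating `𝓔` along a sparse
sublattice and averaging would give a translation-invariant state of smaller mean energy,
`KrausPattern.meanEnergy_cellState_eq`). [cite: BratteliKishimotoRobinson1978, Thm. 2 (proof, `2 ⇒ 1`); Ruelle1969GroundState Thm. 2] -/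
theorem IsMeanEnergyMinimiser.re_expect_le_re_expect_krausMap (hd : 0 < d) {Ψ : FermionInteraction d}
    {R : ℝ} (hR : Ψ.HasFiniteRange R) (hΨE : Ψ.IsEven) (hΨT : Ψ.IsTranslationInvariant)
    {ω : InfVolFermionState d} (hmin : ω.IsMeanEnergyMinimiser Ψ R) (Λ : Finset (Site d)) {m : ℕ}
    (V : Fin m → FermionOp Λ) (hV : ∑ k, (V k)ᴴ * V k = 1)
    (hhom : ∀ k, parityAut (V k) = V k ∨ parityAut (V k) = -V k) :
    (ω.expect (thicken Λ R) (Ψ.localHamiltonian (thicken Λ R))).re ≤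
      (ω.expect (thicken Λ R) (krausMap (PolySite.incl (subset_thicken Λ R)) V
        (Ψ.localHamiltonian (thicken Λ R)))).re := by
  classical
  set P := krausPatternAt Λ R V hV hhom with hP
  haveI : NeZero P.a := ⟨Nat.succ_ne_zero _⟩
  have hωT := hmin.1
  have hωE : ω.IsEven := hωT.isEven hd
  have hsp : ∀ y ∈ P.Λ₀, ∀ y' ∈ P.Λ₀, ∀ i, y i - y' i + ⌊R⌋₊ < P.a := fun y hy y' hy' i =>
    sub_apply_add_lt_of_mem hy hy' i ⌊R⌋₊
  -- minimality against the cell-averaged perturbed state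
  have hle := hmin.2 (P.cellState ω hωE) (P.cellState_isTranslationInvariant ω hωE hωT)
  rw [P.meanEnergy_cellState_eq hR hΨT hΨE hsp ω hωE hωT] at hle
  have hapos : 0 < ((P.a : ℝ) ^ d)⁻¹ := inv_pos.2 (pow_pos (Nat.cast_pos.2 (Nat.succ_pos _)) d)
  have hΔ := (mul_nonneg_iff_of_pos_left hapos).1 (by linarith)
  -- the energy change in `U = (Λ)_{R,R}` equals the one in `Λ_R`
  have hU : P.Λ₀ ⊆ thicken (thicken P.Λ₀ R) R := (subset_thicken _ R).trans (subset_thicken _ R)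
  have h1 := P.sum_delta0_powerset Ψ ω hU
  have h2 : ∑ Z ∈ (thicken Λ R).powerset, P.delta0 Ψ ω Z =
      ω.expect (thicken Λ R) (krausMap (PolySite.incl (subset_thicken Λ R)) V
          (Ψ.localHamiltonian (thicken Λ R))) -
        ω.expect (thicken Λ R) (Ψ.localHamiltonian (thicken Λ R)) :=
    P.sum_delta0_powerset Ψ ω (subset_thicken Λ R)
  have h12 : ∑ Z ∈ (thicken Λ R).powerset, P.delta0 Ψ ω Z =
      ∑ Z ∈ (thicken (thicken Λ R) R).powerset, P.delta0 Ψ ω Z := by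
    refine Finset.sum_subset (Finset.powerset_mono.2 (subset_thicken _ R)) fun Z hZU hZΛ => ?_
    by_cases hdis : Disjoint Z Λ
    · exact P.delta0_eq_zero_of_disjoint hΨE ω hdis
    · obtain ⟨y, hyZ, hyΛ⟩ := Finset.not_disjoint_iff.1 hdis
      obtain ⟨z, hzZ, hz⟩ := Finset.not_subset.1 fun h => hZΛ (Finset.mem_powerset.2 h)
      refine P.delta0_eq_zero_of_apply_eq_zero ω (by_contra fun hne => hz ?_)
      obtain ⟨w, hw, rfl⟩ := Finset.mem_image.1 (hR.subset_image_box hne hyZ hzZ)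
      exact mem_thicken_iff.2 ⟨y, hyΛ, w, hw, rfl⟩
  have hfinal : 0 ≤ (ω.expect (thicken Λ R) (krausMap (PolySite.incl (subset_thicken Λ R)) V
          (Ψ.localHamiltonian (thicken Λ R))) -
        ω.expect (thicken Λ R) (Ψ.localHamiltonian (thicken Λ R))).re := by
    rw [← h2, h12]
    exact h1.symm ▸ hΔ
  rw [Complex.sub_re] at hfinal
  linarith

/-! ### §4. The theorem -/

open scoped Matrix.Norms.L2Operator in
/-- **Translation-invariant minimisers of the mean energy are ground states** (Bratteli–Kishimoto–Robinson
1978, Thm. 2, `(2) ⇒ (1)`; Ruelle 1969, Thm. 2 and Thm. 4), for lattice FERMIONS: let `Φ` be a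
Hermitian, even, translation-invariant interaction of finite range `R` on `ℤ^d`, `d ≥ 1`, and `ω` a
translation-invariant state with `e_Φ(ω) ≤ e_Φ(ω')` for every translation-invariant `ω'`
(`IsMeanEnergyMinimiser`). Then `ω` is a ground state: `-i ω(A⋆δ(A)) ≥ 0` for all local `A`
(`IsGroundState ω Φ R`). The printed proofs are for quantum spin systems; for even interactions of
lattice fermions the statement is the same with graded locality (Araki–Moriya 2003 §7, §12 for the
`β < ∞` analogue), and the proof here is the direct finite-range perturbation argument described in
the module docstring. [cite: BratteliKishimotoRobinson1978, Thm. 2; Ruelle1969GroundState Thm. 2] -/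
theorem IsMeanEnergyMinimiser.isGroundState (hd : 0 < d) {Ψ : FermionInteraction d} {R : ℝ}
    (hR : Ψ.HasFiniteRange R) (hH : Ψ.IsHermitian) (hE : Ψ.IsEven) (hT : Ψ.IsTranslationInvariant)
    {ω : InfVolFermionState d} (hmin : ω.IsMeanEnergyMinimiser Ψ R) : ω.IsGroundState Ψ R := by
  have hωT := hmin.1
  intro Λ A
  have hΛ : Λ ⊆ thicken Λ R := subset_thicken Λ R
  set Λ' := thicken Λ R with hΛ'
  set H := Ψ.localHamiltonian Λ' with hHdef
  have hHh : H.IsHermitian := FermionInteraction.localHamiltonian_isHermitian hH Λ'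
  have hHe : parityAut H = H := FermionInteraction.parityAut_localHamiltonian hE Λ'
  -- Step 1: the Bratteli–Robinson inequality for homogeneous observables
  have hhomog : ∀ A₀ : FermionOp Λ, (parityAut A₀ = A₀ ∨ parityAut A₀ = -A₀) →
      0 ≤ (ω.expect Λ' ((fermionEmbed (PolySite.incl hΛ) A₀)ᴴ *
        (H * fermionEmbed (PolySite.incl hΛ) A₀ - fermionEmbed (PolySite.incl hΛ) A₀ * H))).re := by
    intro A₀ hA₀
    have hN₀ : IsSelfAdjoint (A₀ᴴ * A₀) := isSelfAdjoint_conjTranspose_mul_self A₀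
    have hN₀e : parityAut (A₀ᴴ * A₀) = A₀ᴴ * A₀ := by
      rcases hA₀ with h | h
      · rw [map_mul, parityAut_conjTranspose, h]
      · rw [map_mul, parityAut_conjTranspose, h, Matrix.conjTranspose_neg, neg_mul_neg]
    have ht₁ : 0 < Real.sqrt (1 / (‖A₀ᴴ * A₀‖ + 1)) := Real.sqrt_pos.2 (by positivity)
    refine ω.re_expect_conj_commutator_nonneg_of_cpStable hHh (fermionEmbed (PolySite.incl hΛ) A₀) ht₁
      fun t ht0 ht1 => ?_
    -- `t² x ≤ 1` on `σ(A₀⋆A₀)`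
    have hsp : ∀ x ∈ spectrum ℝ (A₀ᴴ * A₀), t ^ 2 * x ≤ 1 := by
      refine spectrum_smallness A₀ ?_
      have ht2 : t ^ 2 ≤ 1 / (‖A₀ᴴ * A₀‖ + 1) := by
        have := pow_le_pow_left₀ ht0.le ht1 2
        rwa [Real.sq_sqrt (by positivity)] at this
      calc t ^ 2 * ‖A₀ᴴ * A₀‖ ≤ 1 / (‖A₀ᴴ * A₀‖ + 1) * ‖A₀ᴴ * A₀‖ :=
            mul_le_mul_of_nonneg_right ht2 (norm_nonneg _)
        _ ≤ 1 := by
          rw [div_mul_eq_mul_div, one_mul, div_le_one (by positivity)]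
          linarith
    -- the Kraus pair `(tA₀, S_t)` placed at `Λ`
    have hV : ∑ k : Fin 2, (![(t : ℂ) • A₀, krausSqrt t (A₀ᴴ * A₀)] k)ᴴ * ![(t : ℂ) • A₀, krausSqrt t (A₀ᴴ * A₀)] k = 1 := by
      rw [Fin.sum_univ_two]
      exact krausPair_complete A₀ hsp
    have hhomV : ∀ k : Fin 2, parityAut (![(t : ℂ) • A₀, krausSqrt t (A₀ᴴ * A₀)] k) =
        ![(t : ℂ) • A₀, krausSqrt t (A₀ᴴ * A₀)] k ∨
        parityAut (![(t : ℂ) • A₀, krausSqrt t (A₀ᴴ * A₀)] k) = -![(t : ℂ) • A₀, krausSqrt t (A₀ᴴ * A₀)] k := by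
      intro k
      fin_cases k
      · simp only [Fin.zero_eta, Matrix.cons_val_zero, map_smul]
        rcases hA₀ with h | h
        · exact Or.inl (by rw [h])
        · exact Or.inr (by rw [h, smul_neg])
      · simp only [Fin.mk_one, Matrix.cons_val_one, Matrix.cons_val_zero]
        exact Or.inl (by rw [parityAut_krausSqrt t hN₀, hN₀e])
    have hcp := hmin.re_expect_le_re_expect_krausMap hd hR hE hT Λ _ hV hhomV
    rw [krausMap_apply, Fin.sum_univ_two] at hcp
    simp only [Matrix.cons_val_zero, Matrix.cons_val_one, map_smul,
      fermionEmbed_krausSqrt hΛ t hN₀, fermionEmbed_conjTranspose_mul_self] at hcp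
    exact hcp
  -- Step 2: all observables, by splitting into even and odd parts
  have hstabRe : ∀ A : FermionOp Λ,
      0 ≤ (ω.expect Λ' ((fermionEmbed (PolySite.incl hΛ) A)ᴴ *
        (H * fermionEmbed (PolySite.incl hΛ) A - fermionEmbed (PolySite.incl hΛ) A * H))).re := by
    intro A
    have hA := JordanWigner.self_eq_evenPart_add_oddPart A
    have he := JordanWigner.parityAut_evenPart A
    have ho := JordanWigner.parityAut_oddPart A
    set Ae : FermionOp Λ := (1 / 2 : ℂ) • (A + parityAut A) with hAe
    set Ao : FermionOp Λ := (1 / 2 : ℂ) • (A - parityAut A) with hAo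
    set Be := fermionEmbed (PolySite.incl hΛ) Ae with hBe
    set Bo := fermionEmbed (PolySite.incl hΛ) Ao with hBo
    have hpBe : parityAut Be = Be := by rw [hBe, ← fermionEmbed_parityAut, he]
    have hpBo : parityAut Bo = -Bo := by rw [hBo, ← fermionEmbed_parityAut, ho, map_neg]
    have hΓA : fermionEmbed (PolySite.incl hΛ) A = Be + Bo := by
      rw [hBe, hBo, ← map_add, ← hA]
    have hsplit : (Be + Bo)ᴴ * (H * (Be + Bo) - (Be + Bo) * H) =
        Beᴴ * (H * Be - Be * H) + Boᴴ * (H * Bo - Bo * H) +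
          (Beᴴ * (H * Bo - Bo * H) + Boᴴ * (H * Be - Be * H)) := by
      rw [Matrix.conjTranspose_add]
      noncomm_ring
    -- the cross terms are odd, hence have zero expectation
    have hodd₁ : parityAut (Beᴴ * (H * Bo - Bo * H)) = -(Beᴴ * (H * Bo - Bo * H)) := by
      rw [map_mul, map_sub, map_mul, map_mul, parityAut_conjTranspose, hpBe, hpBo, hHe]
      noncomm_ring
    have hodd₂ : parityAut (Boᴴ * (H * Be - Be * H)) = -(Boᴴ * (H * Be - Be * H)) := by
      rw [map_mul, map_sub, map_mul, map_mul, parityAut_conjTranspose, hpBe, hpBo, hHe,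
        Matrix.conjTranspose_neg]
      noncomm_ring
    rw [hΓA, hsplit, map_add, map_add, map_add, hωT.expect_eq_zero_of_odd hd hodd₁,
      hωT.expect_eq_zero_of_odd hd hodd₂, add_zero, add_zero, Complex.add_re]
    exact add_nonneg (hhomog Ae (Or.inl he)) (hhomog Ao (Or.inr ho))
  -- Step 3: stationarity, and the conclusion
  set B := fermionEmbed (PolySite.incl hΛ) A with hB
  have hstat : ω.expect Λ' (H * (Bᴴ * B)) = ω.expect Λ' (Bᴴ * B * H) := by
    have h := ω.expect_commutator_eq_zero_of_localStability hΛ hstabRe (Aᴴ * A)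
    rw [fermionEmbed_conjTranspose_mul_self, map_sub] at h
    exact sub_eq_zero.1 h
  have hder : Ψ.derivation R Λ A = Complex.I • (H * B - B * H) := rfl
  rw [hder, Matrix.mul_smul, map_smul, smul_eq_mul, ← mul_assoc,
    show -Complex.I * Complex.I = 1 by rw [neg_mul, Complex.I_mul_I, neg_neg], one_mul]
  have hre := hstabRe A
  have him : (ω.expect Λ' (Bᴴ * (H * B - B * H))).im = 0 := by
    rw [Matrix.mul_sub, map_sub, Complex.sub_im]
    have h1 : (ω.expect Λ' (Bᴴ * (H * B))).im = 0 := by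
      have hsa : (Bᴴ * (H * B))ᴴ = Bᴴ * (H * B) := by
        rw [Matrix.conjTranspose_mul, Matrix.conjTranspose_mul, hHh.eq, Matrix.conjTranspose_conjTranspose,
          Matrix.mul_assoc]
      have h := ω.expect_conjTranspose Λ' (Bᴴ * (H * B))
      rw [hsa, Complex.star_def] at h
      exact Complex.conj_eq_iff_im.1 h.symm
    have h2 : (ω.expect Λ' (Bᴴ * (B * H))).im = 0 := by
      have hsa : (Bᴴ * (B * H))ᴴ = H * (Bᴴ * B) := by
        rw [Matrix.conjTranspose_mul, Matrix.conjTranspose_mul, hHh.eq, Matrix.conjTranspose_conjTranspose,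
          Matrix.mul_assoc]
      have h := ω.expect_conjTranspose Λ' (Bᴴ * (B * H))
      rw [hsa, hstat, Matrix.mul_assoc, Complex.star_def] at h
      exact Complex.conj_eq_iff_im.1 h.symm
    rw [h1, h2, sub_zero]
  exact Complex.nonneg_iff.2 ⟨hre, him.symm⟩

end InfVolFermionState

end Literature.MathematicalPhysics.QuantumLattice

end
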